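import Literature.AlgebraicGeometry.Modules.PushforwardHasRankOfFibreVanishing
import Literature.AlgebraicGeometry.Modules.PushforwardBaseChangeIsoOfFibreVanishingGeneralBase
import Literature.AlgebraicGeometry.Modules.SerreTwistHom
import Literature.AlgebraicGeometry.Modules.PullbackPushforwardCounitEpiProjective
import Literature.AlgebraicGeometry.Modules.DetClassDual
import Literature.AlgebraicGeometry.Modules.DetClassOfIso
import Literature.AlgebraicGeometry.Morphisms.QuasiCompactPushforwardCoh
import Literature.AlgebraicGeometry.Morphisms.AffineSpaceCompactification
import HarnessLib

/-!
# The twists `𝒪_Z(d)` of a FLAT closed family `Z ⊂ 𝐏(ι; T)` and their direct images `(p_Z)_* 𝒪_Z(d)`: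
# rank and base change from the fibres (Mumford, *Curves on a surface*, Lect. 15 (II.), step (b)_S)

Layer `Literature/AlgebraicGeometry/Modules`, namespace `Literature.AlgebraicGeometry.Modules`; THEOREMS ONLY (no `def`, no
instance, no notation, no named fact, no `sorry`).  Cell `hodgecm-mathlib` (D-0151), F-5 (5d-I) FILE α (director s232, B-plan1
(g16) 08:55:19Z; censuses B-p19 53f83eba §2 S2, B-p09 bb4024e1 (A1), B-p21 e4689c40 (D1)).

SETTING.  `T` locally Noetherian (universe `0`), `ι` a finite index type, `𝐏(ι; T) = T ×_{Spec ℤ} 𝐏ⁿ_ℤ` (★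
`Morphisms/AffineSpaceCompactification.projectiveSpace`), `i : Z ⟶ 𝐏(ι; T)` a closed immersion with `p := i ≫ pr₁ : Z → T`
FLAT; the structure map to `𝐏ⁿ_ℤ = ProjCech.PP ℤ n` is `ι_Z := i ≫ pr₂`, and **`𝒪_Z(d) := SerreTwist.twistMod ι_Z (unitModule Z) d`**
(★ `Modules/SerreTwistMod`: the Čech-gluing model of the positive twist; routing the twist through `𝐏ⁿ_ℤ` makes it ONE global
module although `T` is not affine).

* §1 (any `ι_Z : Z ⟶ 𝐏ʳ_A`) `hasRank_twistMod_unitModule` — **`𝒪_Z(d)` is locally free of rank one** (★ `SerreTwist.sheafHomTwistIso`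
  `𝓗om(𝒪_Z(-d), 𝒪_Z) ≅ 𝒪_Z(d)` + ★ `hasRank_serreTwist` + ★ `hasRank_dual` + ★ `hasRank_of_iso`); `isFiniteLocallyFree_…`,
  `isAffineLocalizing_…`.
* §2 (flat closed families in `𝐏(ι; T)`) `isAffineLocalizing_pushforward_twistMod` (★ B-p09
  `isAffineLocalizing_pushforward_of_isFiniteLocallyFree`), and the two (II.)(b)_S outputs with the FIBREWISE input as binders at
  every field point `x : Spec K → T` (cartesian `X₀ = Z ×_T Spec K`): **`hasRank_pushforward_twistMod_of_forall_fieldPoint`** —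
  `Ext¹(𝒪_{X₀}, 𝒪_Z(d)|_{X₀}) = 0` and `h⁰ = r` on every fibre ⇒ `HasRank ((p_Z)_* 𝒪_Z(d)) r` (★ B-p04 FILE B
  `hasRank_pushforward_of_forall_fieldPoint`), and **`isIso_pushforwardBaseChangeHom_twistMod_of_forall_fieldPoint`** — the base change
  morphism `b^*(p_Z)_*𝒪_Z(d) ⟶ (p_T')_*(pr^*𝒪_Z(d))` is an isomorphism for EVERY cartesian square over `b : T' → T` (★ G10
  `isIso_pushforwardBaseChangeHom_of_forall_fieldPoint`).  The fibrewise inputs are Mumford's uniform regularity read on the fibre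
  `Z_x ⊂ ℙⁿ_K` (★ `HodgeTheory/ProjectiveMumfordRegularityBoundSubschemes.regular_quot_of_hilbertPolynomial_projectiveSpace`, through the
  sheaf↔graded dictionary — NOT in this file; here they are hypotheses, in the letters of FILE B / G10 verbatim).

Count-neutral capital (`--supports stmt-HodgeConjecture-24835`); HC_CM is proved only modulo the 7 printed citations until rung 0 closes,
and this file discharges none of them.

## References
* [Mumford1966CurvesSurface] D. Mumford, *Lectures on Curves on an Algebraic Surface* (1966), Lecture 7 §ii (b)_S and Lecture 15 (II.).
* [Hartshorne1977] R. Hartshorne, *Algebraic Geometry* (1977), II Prop. 5.12 (`𝒪(n)`), III Thm. 12.11 (p. 290), Cor. 12.9.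
* [MumfordAV1970] D. Mumford, *Abelian Varieties* (1970), §5 Cor. 2 (p. 50).
-/

noncomputable section

-- `TopCat.Presheaf`/`Scheme.Modules` are not reducible (as in Mathlib's `AlgebraicGeometry/Modules/Sheaf.lean`).
set_option backward.isDefEq.respectTransparency false

open CategoryTheory CategoryTheory.Limits CategoryTheory.Abelian AlgebraicGeometry TopologicalSpace Opposite

namespace Literature.AlgebraicGeometry.Modules

open Literature.AlgebraicGeometry.Morphisms Literature.AlgebraicGeometry.Morphisms.ProjCech Literature.AlgebraicGeometry.Motives

/-! ### §1 `𝒪_Z(d)` is locally free of rank one -/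

section RankOne

universe u

variable {A : Type u} [CommRing A] {r : ℕ} {Z : Scheme.{u}} (ιZ : Z ⟶ PP A r)

/-- **`𝒪_Z(d) = twistMod ι 𝒪_Z d` has rank one**: `𝒪_Z(d) ≅ 𝓗om(𝒪_Z(-d), 𝒪_Z) = 𝒪_Z(-d)^∨` (★ `sheafHomTwistIso`) and
`𝒪_Z(-d) = serreTwist ι d` has rank one (★ `hasRank_serreTwist`, ★ `hasRank_dual`). [cite: Hartshorne1977, II Prop. 5.12] -/
theorem hasRank_twistMod_unitModule (d : ℕ) : HasRank (SerreTwist.twistMod ιZ (unitModule Z) d) 1 :=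
  hasRank_of_iso (SerreTwist.sheafHomTwistIso ιZ (unitModule Z) d) (hasRank_dual (SerreTwist.hasRank_serreTwist ιZ d))

/-- `𝒪_Z(d)` is finite locally free. [cite: Hartshorne1977, II Prop. 5.12] -/
theorem isFiniteLocallyFree_twistMod_unitModule (d : ℕ) : IsFiniteLocallyFree (SerreTwist.twistMod ιZ (unitModule Z) d) :=
  HasRank.isFiniteLocallyFree' (hasRank_twistMod_unitModule ιZ d)

/-- `𝒪_Z(d)` is affine-localizing (quasi-coherent). [cite: Hartshorne1977, II Prop. 5.12] -/
theorem isAffineLocalizing_twistMod_unitModule (d : ℕ) : IsAffineLocalizing (SerreTwist.twistMod ιZ (unitModule Z) d) :=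
  haveI := (isFiniteLocallyFree_twistMod_unitModule ιZ d).isVectorBundle.1
  IsAffineLocalizing.of_isQuasicoherent _

end RankOne

/-! ### §2 Flat closed families `Z ⊂ 𝐏(ι; T)`: rank and base change of `(p_Z)_* 𝒪_Z(d)` from the fibres -/

section Family

variable {ι : Type} {T Z : Scheme.{0}} [IsLocallyNoetherian T] (i : Z ⟶ projectiveSpace ι T)
  [IsClosedImmersion i]

/-- **`(p_Z)_* 𝒪_Z(d)` is affine-localizing** (`p_Z` proper, `T` locally Noetherian, `𝒪_Z(d)` finite locally free — ★ B-p09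
`isAffineLocalizing_pushforward_of_isFiniteLocallyFree`). [cite: Hartshorne1977, II Prop. 5.8 (c) (p. 115)] -/
theorem isAffineLocalizing_pushforward_twistMod (d : ℕ) :
    IsAffineLocalizing ((Scheme.Modules.pushforward (i ≫ projectiveSpaceFst ι T)).obj
      (SerreTwist.twistMod (i ≫ pullback.snd (terminal.from T) (terminal.from (projectiveSpaceInt ι)))
        (unitModule Z) d)) :=
  isAffineLocalizing_pushforward_of_isFiniteLocallyFree (i ≫ projectiveSpaceFst ι T)
    (isFiniteLocallyFree_twistMod_unitModule
      (i ≫ pullback.snd (terminal.from T) (terminal.from (projectiveSpaceInt ι))) d)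

/-- **Lect. 15 (II.)(b)_S, RANK: `(p_Z)_* 𝒪_Z(d)` is locally free of rank `r`** for a FLAT closed family `Z ⊂ 𝐏(ι; T)` as soon as on
every field-valued fibre `X₀ = Z ×_T Spec K` one has `Ext¹(𝒪_{X₀}, 𝒪_Z(d)|_{X₀}) = 0` and `dim_K Γ(X₀, 𝒪_Z(d)|_{X₀}) = r` (★ FILE B
`hasRank_pushforward_of_forall_fieldPoint`, hypotheses discharged: `p_Z` proper, `𝒪_Z(d)` finite locally free, the direct image
affine-localizing). [cite: Mumford1966CurvesSurface, Lecture 15 (II.)] [cite: Hartshorne1977, III Thm. 12.11 (p. 290), Cor. 12.9]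
[cite: MumfordAV1970, §5 Cor. 2 (p. 50)] -/
theorem hasRank_pushforward_twistMod_of_forall_fieldPoint [Flat (i ≫ projectiveSpaceFst ι T)] (d r : ℕ)
    (hvan : ∀ ⦃K : Type⦄ [Field K] ⦃X₀ : Scheme.{0}⦄ (k : X₀ ⟶ Z) (f₀ : X₀ ⟶ Spec (CommRingCat.of K))
      (x : Spec (CommRingCat.of K) ⟶ T), IsPullback k f₀ (i ≫ projectiveSpaceFst ι T) x →
        Subsingleton (Ext.{1} (unitModule X₀) ((Scheme.Modules.pullback k).obj
          (SerreTwist.twistMod (i ≫ pullback.snd (terminal.from T) (terminal.from (projectiveSpaceInt ι)))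
            (unitModule Z) d)) 1))
    (hrank : ∀ ⦃K : Type⦄ [Field K] ⦃X₀ : Scheme.{0}⦄ (k : X₀ ⟶ Z) (f₀ : X₀ ⟶ Spec (CommRingCat.of K))
      (x : Spec (CommRingCat.of K) ⟶ T), IsPullback k f₀ (i ≫ projectiveSpaceFst ι T) x →
        Module.finrank Γ(Spec (CommRingCat.of K), ⊤) (SecMod ((Scheme.Modules.pullback k).obj
          (SerreTwist.twistMod (i ≫ pullback.snd (terminal.from T) (terminal.from (projectiveSpaceInt ι)))
            (unitModule Z) d)) f₀.appTop.hom ⊤) = r) :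
    HasRank ((Scheme.Modules.pushforward (i ≫ projectiveSpaceFst ι T)).obj
      (SerreTwist.twistMod (i ≫ pullback.snd (terminal.from T) (terminal.from (projectiveSpaceInt ι)))
        (unitModule Z) d)) r :=
  hasRank_pushforward_of_forall_fieldPoint _ (isFiniteLocallyFree_twistMod_unitModule _ d)
    (isAffineLocalizing_pushforward_twistMod i d) r hvan hrank

/-- **Lect. 15 (II.)(b)_S, BASE CHANGE: the formation of `(p_Z)_* 𝒪_Z(d)` commutes with EVERY base change `b : T' → T`** (the
canonical `b^*(p_Z)_*𝒪_Z(d) ⟶ (p_{T'})_*(pr^*𝒪_Z(d))` of ★ `Modules/PushforwardBaseChangeHom` is an isomorphism) for a FLAT closed family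
with `Ext¹(𝒪_{X₀}, 𝒪_Z(d)|_{X₀}) = 0` on every field-valued fibre (★ G10 `isIso_pushforwardBaseChangeHom_of_forall_fieldPoint`).
[cite: Mumford1966CurvesSurface, Lecture 15 (II.)] [cite: Hartshorne1977, III Thm. 12.11 (p. 290), Cor. 12.9] -/
theorem isIso_pushforwardBaseChangeHom_twistMod_of_forall_fieldPoint [Flat (i ≫ projectiveSpaceFst ι T)] (d : ℕ)
    (hvan : ∀ ⦃K : Type⦄ [Field K] ⦃X₀ : Scheme.{0}⦄ (k : X₀ ⟶ Z) (f₀ : X₀ ⟶ Spec (CommRingCat.of K))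
      (x : Spec (CommRingCat.of K) ⟶ T), IsPullback k f₀ (i ≫ projectiveSpaceFst ι T) x →
        Subsingleton (Ext.{1} (unitModule X₀) ((Scheme.Modules.pullback k).obj
          (SerreTwist.twistMod (i ≫ pullback.snd (terminal.from T) (terminal.from (projectiveSpaceInt ι)))
            (unitModule Z) d)) 1))
    {T' ZT' : Scheme.{0}} {pr : ZT' ⟶ Z} {pT' : ZT' ⟶ T'} {b : T' ⟶ T}
    (H : IsPullback pr pT' (i ≫ projectiveSpaceFst ι T) b) :
    IsIso (pushforwardBaseChangeHom H.w
      (SerreTwist.twistMod (i ≫ pullback.snd (terminal.from T) (terminal.from (projectiveSpaceInt ι)))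
        (unitModule Z) d)) :=
  isIso_pushforwardBaseChangeHom_of_forall_fieldPoint _ (isFiniteLocallyFree_twistMod_unitModule _ d)
    (isAffineLocalizing_pushforward_twistMod i d) hvan H

end Family

end Literature.AlgebraicGeometry.Modules

end
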